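import Summits.KontsevichZagierPeriods.KontsevichZagierPeriods.Theorems.SymplecticScissorsRealOnePeriodRelationsIsoLayer
import Summits.KontsevichZagierPeriods.KontsevichZagierPeriods.Theorems.SymplecticScissorsRealOnePeriodRelationsStubEllNormalForm
import Summits.KontsevichZagierPeriods.KontsevichZagierPeriods.Theorems.SymplecticScissorsRealOnePeriodRelationsStubManyPathsCore
import Literature.NumberTheory.Transcendental.ManyCurveSemistable

/-!
# `RealOnePeriodRelations` (stmt-KontsevichZagierPeriods-10042), line `nash-retraction-thin-strip`, reshape 7:
# the MULTI-CURVE OPEN-PATH layer of the crux, from the family hyperplane theorem at general points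

The tree's transcendence reaches ARBITRARY paths on ONE non-CM elliptic curve (the analytic subgroup theorem for
`𝔾ₐ × 𝔾ₘ^ι × (E♮)^κ` at all algebraic points) and CLOSED paths on any finite family (the family semistability engine at
points with TORSION abelian part).  Open paths on SEVERAL pairwise non-isogenous curves need the family engine at GENERAL
algebraic points — Baker–Wüstholz's Thm 6.15 for the quotients of `G = 𝔾ₐ × 𝔾ₘ^ι × ∏_b E_{M_{cls b}}♮` in hyperplane form, i.e. the
tree's predicate `(GaGmEFam.pres M cls ι hM).HyperplaneTheorem` (proved in the tree at torsion points only,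
`GaGmEFam.Std.hyperplaneTheorem_presTors_of_std_torsHyperplane`; its one-class case at all points is
`MultiEllLayer.stub_famHyperplaneOneClass`).  This file does the whole SYMBOL side unconditionally and isolates that predicate as
the one hypothesis:

* `alternatives_of_hyperplaneTheorem` — the analytic-subgroup alternatives at general algebraic points of `G` from the
  hyperplane theorem (dévissage `LiePresentation.linearIndependent_of_hyperplaneTheorem` + minimality
  `GaGmEFam.SubgroupData.tangent_eq_top_of_mem`);
* `manyIsoPaths_of_core` — transfer of Huber–Wüstholz 13.3 (2) from the core sector (symbols on the `E_{M_i}`, `𝔾ₘ`, `𝔸¹`) to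
  isogenous models and punctured lines (`Ell.Isog.exists_transfer_symbol`, `exists_transfer_puncturedLine`,
  `span_of_transfer_finsupp`);
* `manyIsoPaths_of_hyperplaneTheorem` — Huber–Wüstholz 13.3 (2) for arbitrary paths on a finite non-CM family, from the landed
  stubs `stub_ellNormalForm` (per-curve lift normal form) and `stub_manyPathsCore` (the family endgame);
* `realOnePeriodRelations_multiIsoLayer_of_hyperplaneTheorem` — THE LAYER THEOREM: every `ℤ`-relation with value `0` among
  rational representations, first/second-kind real abelian integrals with algebraic end points and convergent first-kind tails
  on ANY finite family of real non-CM Weierstrass curves `y² = x³ + A_j x + B_j` (lattices isogenous into the `M_i`) lies in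
  `M₁ = closure (1a ∪ 1b ∪ 2 ∪ Green)`, given the hyperplane theorem for the `M_i` (`SectorGlue.realOnePeriodRelations_of_sector`
  with `IsoLayer.isoCells` / `IsoLayer.isoArcs`).

References: A. Huber, G. Wüstholz, *Transcendence and Linear Relations of 1-Periods* (CUP 2022), Thm 13.3 (2), §13.2, Ch. 15,
Thm 6.2; A. Baker, G. Wüstholz, *Logarithmic Forms and Diophantine Geometry* (CUP 2007), Thm 6.15, §6.8; M. Kontsevich, D. Zagier,
*Periods* (2001), §1.2.
-/

noncomputable section

open scoped BigOperators Polynomial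
open Set MeasureTheory MvPolynomial Complex
open Literature.NumberTheory.Transcendental Literature.NumberTheory.Transcendental.CurvePeriods
open Summit.KontsevichZagierPeriods.SymplecticScissors.RealOnePeriodRelationsNegative (M₁ H₁)

namespace Summit.KontsevichZagierPeriods.SymplecticScissors.RealOnePeriodRelations

namespace MultiEllLayer

-- `stub_ellNormalForm` (p138982) and `stub_manyPathsCore` (p139988) are LANDED (imported above, same namespace).

/-- **The alternatives at general algebraic points from the hyperplane theorem for the quotients of
`G = 𝔾ₐ × 𝔾ₘ^ι × ∏_b E_{cls b}♮`** (the hypothesis of `stub_manyPathsCore`): if `exp_G(u)` is algebraic and the coordinates of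
`u = (x; y; z; t)` are `ℚ̄`-linearly dependent, then `x = 0`, or the `yᵢ` satisfy a non-trivial integer relation, or the
`z`-coordinates of some class do — `GaGmEFam.hyperplane_of_semistabilityTheorem` verbatim with the hyperplane dévissage
`LiePresentation.linearIndependent_of_hyperplaneTheorem`. [cite: BakerWustholz2007, §6.8 (Thm 6.1 from Thm 6.15)] [cite: HuberWustholz2022, Thm 6.2] -/
theorem alternatives_of_hyperplaneTheorem : ∀ {J : Type} [Fintype J] [DecidableEq J] {L : J → PeriodPair} {B ι : Type} [Fintype ι] [Fintype B] {cls : B → J}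
    (hL : ∀ i, IsAlgebraic ℚ (L i).g₂ ∧ IsAlgebraic ℚ (L i).g₃), (GaGmEFam.pres L cls ι hL).HyperplaneTheorem →
    ∀ (x : ℂ) (y : ι → ℂ) (z t : B → ℂ), IsAlgebraic ℚ x → (∀ i, IsAlgebraic ℚ (cexp (y i))) →
    (∀ b, (L (cls b)).IsUnivExtAlgPoint (z b) (t b)) → ¬ QbarLinearIndependent (lieCoords x y z t) →
    x = 0 ∨ (∃ p : ι → ℤ, p ≠ 0 ∧ ∑ i, (p i : ℂ) * y i = 0) ∨
    (∃ (i : J) (a : B → ℤ), a ≠ 0 ∧ (∀ b, cls b ≠ i → a b = 0) ∧ ∑ b, (a b : ℂ) * z b = 0) := by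
  intro J _ _ L B ι _ _ cls hL hH x y z t hx hy hzt hdep
  classical
  by_contra hcon
  simp only [not_or, not_exists, not_and] at hcon
  obtain ⟨hx0, hny, hnz⟩ := hcon
  set P := GaGmEFam.pres L cls ι hL with hP
  have hu : lieCoords x y z t ∈ P.Alg := ⟨hx, hy, hzt⟩
  have hmin : ∀ 𝔥 ∈ P.algLie, lieCoords x y z t ∈ 𝔥 → 𝔥 = ⊤ := by
    rintro _ ⟨D, rfl⟩ huD
    exact D.tangent_eq_top_of_mem hx0 hny (fun i a ha hsupp => hnz i a ha hsupp) huD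
  exact hdep (GaGmEE.qbarLinearIndependent_of_pair_eq_zero
    (P.linearIndependent_of_hyperplaneTheorem hH hu hmin))

/-- **Transfer onto the core sector**: Huber–Wüstholz 13.3 (2) for symbols on the curves `E_{M_i}` of a family together with
`𝔾ₘ` and `𝔸¹` (hypothesis `hcore`) implies it for symbols on every `E_L` admitting an algebraic isogeny `z ↦ αz` into some `E_{M_i}`,
on the punctured lines `Z_a`, on the `E_{M_i}`, on `𝔾ₘ` and on `𝔸¹` — by the tree's transfer lemmas `Ell.Isog.exists_transfer_symbol`
(functoriality along the isogeny), `exists_transfer_puncturedLine` and `span_of_transfer_finsupp`.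
[cite: HuberWustholz2022, Thm 13.3 (2), §13.1 (B), §13.2] -/
theorem manyIsoPaths_of_core {J : Type} (M : J → PeriodPair)
    (hM : ∀ i, IsAlgebraic ℚ (M i).g₂ ∧ IsAlgebraic ℚ (M i).g₃)
    (hcore : ∀ c : PeriodSymbol →₀ ℂ, (∀ s, IsAlgebraic ℚ (c s)) →
      (∀ s ∈ c.support, (∃ i, s.Z = Ell.curve (M i)) ∨ s.Z = (⟨2, 1, ![X 0 * X 1 - 1]⟩ : CurveData) ∨
        s.Z = CurveData.affineLine) →
      evalCombination c = 0 →
      ∃ (k : ℕ) (ρ : Fin k → (PeriodSymbol →₀ ℂ)) (a : Fin k → ℂ),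
        (∀ l, IsElementaryRelation (ρ l)) ∧ (∀ l, IsAlgebraic ℚ (a l)) ∧ c = ∑ l, a l • ρ l)
    (c : PeriodSymbol →₀ ℂ) (hc : ∀ s, IsAlgebraic ℚ (c s))
    (hsupp : ∀ s ∈ c.support,
      (∃ (i : J) (L : PeriodPair) (α : ℂ), IsAlgebraic ℚ L.g₂ ∧ IsAlgebraic ℚ L.g₃ ∧ α ≠ 0 ∧ IsAlgebraic ℚ α ∧
          (∀ l ∈ L.lattice, α * l ∈ (M i).lattice) ∧ s.Z = Ell.curve L) ∨
      (∃ (r : ℕ) (a : Fin r → ℂ), Function.Injective a ∧ (∀ i, IsAlgebraic ℚ (a i)) ∧ s.Z = (⟨2, 1, ![X 1 * ∏ i, (X 0 - C (a i)) - 1]⟩ : CurveData)) ∨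
      (∃ i, s.Z = Ell.curve (M i)) ∨ s.Z = (⟨2, 1, ![X 0 * X 1 - 1]⟩ : CurveData) ∨ s.Z = CurveData.affineLine)
    (h0 : evalCombination c = 0) :
    ∃ (k : ℕ) (ρ : Fin k → (PeriodSymbol →₀ ℂ)) (a : Fin k → ℂ),
      (∀ l, IsElementaryRelation (ρ l)) ∧ (∀ l, IsAlgebraic ℚ (a l)) ∧ c = ∑ l, a l • ρ l := by
  classical
  have key : ∀ s : PeriodSymbol, ∃ V : PeriodSymbol →₀ ℂ, s ∈ c.support →
      ((∀ t, IsAlgebraic ℚ (V t)) ∧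
        (∃ (k : ℕ) (ρ : Fin k → (PeriodSymbol →₀ ℂ)) (a : Fin k → ℂ), (∀ l, IsElementaryRelation (ρ l)) ∧
          (∀ l, IsAlgebraic ℚ (a l)) ∧ Finsupp.single s 1 - V = ∑ l, a l • ρ l) ∧
        (∀ t ∈ V.support,
          (∃ i, t.Z = Ell.curve (M i)) ∨ t.Z = (⟨2, 1, ![X 0 * X 1 - 1]⟩ : CurveData) ∨
            t.Z = CurveData.affineLine)) := by
    intro s
    by_cases hs : s ∈ c.support
    · rcases hsupp s hs with ⟨i, L, α, hL₂, hL₃, hα0, hαalg, hαL, hsZ⟩ | ⟨r, a, hinj, ha, hsZ⟩ | hrest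
      · obtain ⟨Z, hZ, ω, hω, γ⟩ := s
        dsimp only at hsZ
        subst hsZ
        obtain rfl : hZ = Ell.smooth L hL₂ hL₃ := rfl
        obtain ⟨S, hR⟩ := Ell.Isog.exists_reps hα0 hαalg hαL
        obtain ⟨V, hValg, hVrel, hVsupp⟩ :=
          Ell.Isog.exists_transfer_symbol hR hL₂ hL₃ (hM i).1 (hM i).2 ω hω γ
        exact ⟨V, fun _ => ⟨hValg, hVrel, fun t ht => by
          rcases hVsupp t ht with ⟨h, -⟩ | h
          · exact Or.inl ⟨i, h⟩
          · exact Or.inr (Or.inr h)⟩⟩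
      · obtain ⟨Z, hZ, ω, hω, γ⟩ := s
        dsimp only at hsZ
        subst hsZ
        obtain rfl : hZ = isSmoothAffineCurve_puncturedLine ha := rfl
        obtain ⟨cf, γ', e, hcf, he, hrel⟩ := exists_transfer_puncturedLine ha hinj ω hω γ
        refine ⟨∑ i, cf i • Finsupp.single (⟨⟨2, 1, ![X 0 * X 1 - 1]⟩,
            isSmoothAffineCurve_mulGroup, ![X 1, 0], hasAlgCoeffs_ydx, γ' i⟩ : PeriodSymbol)
            (1 : ℂ) + e • Finsupp.single PeriodSymbol.unit (1 : ℂ), fun _ => ⟨?_, ?_, ?_⟩⟩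
        · intro t
          rw [Finsupp.add_apply, Finsupp.finsetSum_apply, Finsupp.smul_apply, smul_eq_mul]
          refine (isAlgebraic_finsetSum _ _ fun i _ => ?_).add
            (he.mul (isAlgebraic_single_one_apply _ _))
          rw [Finsupp.smul_apply, smul_eq_mul]
          exact (hcf i).mul (isAlgebraic_single_one_apply _ _)
        · obtain ⟨k, ρ, b, hρ, hb, hsum⟩ := hrel
          exact ⟨k, ρ, b, hρ, hb, by rw [← hsum]; abel⟩
        · intro t ht
          rcases Finset.mem_union.1 (Finsupp.support_add ht) with h1 | h2
          · obtain ⟨i, _, hi⟩ := Finset.mem_biUnion.1 (Finsupp.support_finsetSum h1)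
            have h3 := (Finsupp.mem_support_single _ _ _).1 (Finsupp.support_smul hi)
            exact Or.inr (Or.inl (by rw [h3.1]))
          · have h3 := (Finsupp.mem_support_single _ _ _).1 (Finsupp.support_smul h2)
            exact Or.inr (Or.inr (by rw [h3.1]; rfl))
      · exact ⟨Finsupp.single s 1, fun _ => ⟨fun t => isAlgebraic_single_one_apply _ _,
          by rw [sub_self]; exact span_zero, fun t ht => by
            have h3 := (Finsupp.mem_support_single _ _ _).1 ht
            rw [h3.1]
            exact hrest⟩⟩
    · exact ⟨0, fun h => (hs h).elim⟩
  choose V hV using key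
  exact span_of_transfer_finsupp c hc V (fun s hs => (hV s hs).1) (fun s hs => (hV s hs).2.1)
    (fun t => (∃ i, t.Z = Ell.curve (M i)) ∨ t.Z = (⟨2, 1, ![X 0 * X 1 - 1]⟩ : CurveData) ∨
      t.Z = CurveData.affineLine)
    (fun s hs => (hV s hs).2.2)
    (fun c' hc' hsupp' h0' => hcore c' hc' hsupp' h0') h0

/-- **Huber–Wüstholz 13.3 (2) for ARBITRARY paths on a finite family of pairwise non-isogenous non-CM curves, their isogenous
models, the punctured lines, `𝔾ₘ` and `𝔸¹` — from the hyperplane theorem for the quotients of `G` at general algebraic points.**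
Composition of `alternatives_of_hyperplaneTheorem`, `stub_ellNormalForm`, `stub_manyPathsCore` and `manyIsoPaths_of_core`.
[cite: HuberWustholz2022, Thm 13.3 (2), §13.2, Ch. 15] [cite: BakerWustholz2007, Thm 6.15] -/
theorem manyIsoPaths_of_hyperplaneTheorem {J : Type} [Fintype J] [DecidableEq J] (M : J → PeriodPair)
    (hM : ∀ i, IsAlgebraic ℚ (M i).g₂ ∧ IsAlgebraic ℚ (M i).g₃)
    (hH : ∀ (ι B : Type) [Fintype ι] [Fintype B] (cls : B → J), (GaGmEFam.pres M cls ι hM).HyperplaneTheorem)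
    (c : PeriodSymbol →₀ ℂ) (hc : ∀ s, IsAlgebraic ℚ (c s))
    (hsupp : ∀ s ∈ c.support,
      (∃ (i : J) (L : PeriodPair) (α : ℂ), IsAlgebraic ℚ L.g₂ ∧ IsAlgebraic ℚ L.g₃ ∧ α ≠ 0 ∧ IsAlgebraic ℚ α ∧
          (∀ l ∈ L.lattice, α * l ∈ (M i).lattice) ∧ s.Z = Ell.curve L) ∨
      (∃ (r : ℕ) (a : Fin r → ℂ), Function.Injective a ∧ (∀ i, IsAlgebraic ℚ (a i)) ∧ s.Z = (⟨2, 1, ![X 1 * ∏ i, (X 0 - C (a i)) - 1]⟩ : CurveData)) ∨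
      (∃ i, s.Z = Ell.curve (M i)) ∨ s.Z = (⟨2, 1, ![X 0 * X 1 - 1]⟩ : CurveData) ∨ s.Z = CurveData.affineLine)
    (h0 : evalCombination c = 0) :
    ∃ (k : ℕ) (ρ : Fin k → (PeriodSymbol →₀ ℂ)) (a : Fin k → ℂ),
      (∀ l, IsElementaryRelation (ρ l)) ∧ (∀ l, IsAlgebraic ℚ (a l)) ∧ c = ∑ l, a l • ρ l :=
  manyIsoPaths_of_core M hM
    (fun c' hc' hsupp' h0' => stub_manyPathsCore M hM
      (fun j T hT => stub_ellNormalForm (M j) (hM j).1 (hM j).2 T hT)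
      (fun ι B _ _ cls x y z t hx hy hzt hdep =>
        alternatives_of_hyperplaneTheorem hM (hH ι B cls) x y z t hx hy hzt hdep)
      c' hc' hsupp' h0')
    c hc hsupp h0

/-- **THE MULTI-CURVE OPEN-PATH LAYER OF THE CRUX, from the family hyperplane theorem at general points.**  Let `M_i`
(`i ∈ J`, finite) be lattices with algebraic invariants and without complex multiplication such that Baker–Wüstholz's
hyperplane theorem holds for the quotients of `𝔾ₐ × 𝔾ₘ^ι × ∏_b E_{M_{cls b}}♮` at all algebraic points (hypothesis `hH`; the named
fact `hyperplaneTheorem_GaGmEFam` supplies it for pairwise non-isogenous `M_i`), and let `E_j : y² = x³ + A_j x + B_j` (`j ∈ ι`,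
`A_j, B_j` real algebraic) be real Weierstrass curves whose lattices `L_j` map by algebraic isogenies `z ↦ α_j z` into `M_{κ j}`.
Every `ℤ`-combination with vanishing value of rational representations, first/second-kind real abelian integrals on the `E_j`
(integrand `P₁ + P₂√f_j + P₃/√f_j` on an interval of positivity of `f_j` with algebraic end points) and convergent tails
`c₀/√f_j` on `(M′, ∞)` lies in `M₁ = closure (1a ∪ 1b ∪ 2 ∪ Green)`.  Proof: `SectorGlue.realOnePeriodRelations_of_sector` with
`IsoLayer.isoCells`, `IsoLayer.isoArcs` and `manyIsoPaths_of_hyperplaneTheorem`.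
[cite: HuberWustholz2022, Thm 13.3 (2), §13.2, Ch. 15] [cite: BakerWustholz2007, Thm 6.15] [cite: KontsevichZagier2001, §1.2] -/
theorem realOnePeriodRelations_multiIsoLayer_of_hyperplaneTheorem : ∀ {ι J : Type} [Fintype J] [DecidableEq J]
    (A B : ι → ℝ), (∀ j, IsAlgebraic ℚ (A j)) → (∀ j, IsAlgebraic ℚ (B j)) →
    ∀ (M : J → PeriodPair) (hM : ∀ i, IsAlgebraic ℚ (M i).g₂ ∧ IsAlgebraic ℚ (M i).g₃), (∀ i, ¬ (M i).HasCM) →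
    (∀ (ι' Bk : Type) [Fintype ι'] [Fintype Bk] (cls : Bk → J), (GaGmEFam.pres M cls ι' hM).HyperplaneTheorem) →
    ∀ (L : ι → PeriodPair) (κ : ι → J) (α : ι → ℂ), (∀ j, (L j).g₂ = -4 * (A j : ℂ)) → (∀ j, (L j).g₃ = -4 * (B j : ℂ)) →
    (∀ j, α j ≠ 0) → (∀ j, IsAlgebraic ℚ (α j)) → (∀ j, ∀ l ∈ (L j).lattice, α j * l ∈ (M (κ j)).lattice) →
    ∀ c : KZ.FormalRep, c ∈ AddSubgroup.closure ((fun r : KZ.IntegralRep 1 => KZ.of r) ''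
      {r | r.IsRational ∨
        (∃ j, ∃ a b : ℝ, IsAlgebraic ℚ a ∧ IsAlgebraic ℚ b ∧ a < b ∧ r.domain = {z | z 0 ∈ Set.Ioo a b} ∧
          (∀ x ∈ Set.Ioo a b, 0 < x ^ 3 + A j * x + B j) ∧
          ∃ P₁ P₂ P₃ : Polynomial (algebraicClosure ℚ ℝ), ∀ x ∈ Set.Ioo a b,
            r.integrand (fun _ => x) = Polynomial.aeval x P₁ + Polynomial.aeval x P₂ * Real.sqrt (x ^ 3 + A j * x + B j) +
              Polynomial.aeval x P₃ / Real.sqrt (x ^ 3 + A j * x + B j)) ∨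
        (∃ j, ∃ e M c₀ : ℝ, IsAlgebraic ℚ e ∧ IsAlgebraic ℚ M ∧ IsAlgebraic ℚ c₀ ∧ e ^ 3 + A j * e + B j = 0 ∧
          0 < 3 * e ^ 2 + A j ∧ e < M ∧ (∀ x : ℝ, e < x → 0 < x ^ 3 + A j * x + B j) ∧ r.domain = {z | M < z 0} ∧
          ∀ z ∈ r.domain, r.integrand z = c₀ / Real.sqrt ((z 0) ^ 3 + A j * (z 0) + B j))}) →
    KZ.eval c = 0 →
    c ∈ AddSubgroup.closure (KZ.domainAddRel ∪ KZ.integrandAddRel ∪ KZ.changeOfVariablesRel ∪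
      {g : KZ.FormalRep | ∃ (Δ : Set (Fin 2 → ℝ)) (A B S : (Fin 2 → ℝ) → ℝ) (r₀₁ r₁₂ r₀₂ : KZ.IntegralRep 1),
        Δ = {p | 0 ≤ p 0 ∧ 0 ≤ p 1 ∧ p 0 + p 1 ≤ 1} ∧ IsSemialgebraicFunOn ℚ Δ A ∧ IsSemialgebraicFunOn ℚ Δ B ∧
        ContinuousOn A Δ ∧ ContinuousOn B Δ ∧
        (∀ p : Fin 2 → ℝ, 0 < p 0 → 0 < p 1 → p 0 + p 1 < 1 →
          HasFDerivAt S (A p • ContinuousLinearMap.proj (R := ℝ) (φ := fun _ : Fin 2 => ℝ) 0 +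
            B p • ContinuousLinearMap.proj (R := ℝ) (φ := fun _ : Fin 2 => ℝ) 1) p) ∧
        r₀₁.domain = {z | z 0 ∈ Set.Ioo 0 1} ∧ r₁₂.domain = {z | z 0 ∈ Set.Ioo 0 1} ∧
        r₀₂.domain = {z | z 0 ∈ Set.Ioo 0 1} ∧ (∀ z ∈ r₀₁.domain, r₀₁.integrand z = A ![z 0, 0]) ∧
        (∀ z ∈ r₁₂.domain, r₁₂.integrand z = B ![1 - z 0, z 0] - A ![1 - z 0, z 0]) ∧
        (∀ z ∈ r₀₂.domain, r₀₂.integrand z = B ![0, z 0]) ∧ g = KZ.of r₀₁ + KZ.of r₁₂ - KZ.of r₀₂}) := by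
  intro ι J _ _ A B hA hB M hM hCM hH L κ α hL₂ hL₃ hα hαalg hαM c hc heval
  change c ∈ M₁
  have hD : ∀ j, 4 * A j ^ 3 + 27 * B j ^ 2 ≠ 0 := by
    intro j h
    apply (L j).discr_ne_zero
    rw [hL₂ j, hL₃ j]
    have h' : ((4 * A j ^ 3 + 27 * B j ^ 2 : ℝ) : ℂ) = 0 := by rw [h]; simp
    push_cast at h'
    linear_combination (-16 : ℂ) * h'
  have hg₂ : ∀ j, IsAlgebraic ℚ (L j).g₂ := fun j => by
    rw [hL₂ j]; exact ((isAlgebraic_int 4).neg).mul (hA j).algebraMap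
  have hg₃ : ∀ j, IsAlgebraic ℚ (L j).g₃ := fun j => by
    rw [hL₃ j]; exact ((isAlgebraic_int 4).neg).mul (hB j).algebraMap
  refine SectorGlue.realOnePeriodRelations_of_sector _ _ _ (fun C hCalg hCsupp hC0 => ?_)
    (IsoLayer.isoCells A B hA hB) (IsoLayer.isoArcs A B hA hB hD) c hc heval
  refine manyIsoPaths_of_hyperplaneTheorem M hM hH C hCalg (fun s hs => ?_) hC0
  rcases hCsupp s hs with hP | ⟨j, hj⟩
  · exact Or.inr (Or.inl hP)
  · exact Or.inl ⟨κ j, L j, α j, hg₂ j, hg₃ j, hα j, hαalg j, hαM j,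
      hj.trans (Ell.curve_eq_weierCurve (hL₂ j) (hL₃ j)).symm⟩

end MultiEllLayer

end Summit.KontsevichZagierPeriods.SymplecticScissors.RealOnePeriodRelations

end
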